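import Mathlib
import Literature.NumberTheory.Transcendental.KZRulesAssociator
import Literature.NumberTheory.Transcendental.KZProductIdeal
import Literature.NumberTheory.Transcendental.KZCalculusProofs
import Literature.NumberTheory.Transcendental.KZLogCalculusProofs
import Literature.NumberTheory.Transcendental.KZIntervalPeriodProofs
import Literature.NumberTheory.Transcendental.KZMellinFibres

/-!
# Stub `stub_arctanBoxPower` — crux `OffTetraSectorKernel`, line `odd-hyperbolic-ladder` (skeleton v8, lead c6)

ARCTANGENT BOXES ARE POWERS OF THE ARCTANGENT CARRIER. In the formal period ring
`P = FormalRep ⧸ relations` of the Kontsevich–Zagier calculus (`KZ.FormalPeriodRing`, product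
induced by the Fubini product of representations, `KZ.toFormalPeriod_of_mul_of`), let
`A = [(0,1), 1/(1+t²)]` be an arctangent carrier (value `arctan 1 = π/4`) and, for `n : ℕ`, let
`B = [(0,1)ⁿ, ∏ᵢ 1/(1+xᵢ²)]` be a representation pinned as the `n`-dimensional arctangent box
(value `(π/4)ⁿ`; these are, up to a rational factor, the right-hand sides of the landed
`ZetaEvenBKC`, i.e. the even zeta values). THEOREM (`stub_arctanBoxPower`): `⟦B⟧ = ⟦A⟧ⁿ` in `P`.

Proof: induction on `n`. For `n = 0` the box is `[ℝ⁰, 1]`, which agrees with the unit `[pt, 1]`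
(`KZ.IntegralRep.unit`, the `1` of `P`) on its domain: one integrand-additivity move
(`KZ.of_sub_of_mem_relations_of_eqOn`). For `n + 1`: an `n`-dimensional arctangent box `Bₙ`
EXISTS (`arctanBox_exists`: the open box is `ℚ`-semialgebraic, the integrand is the reciprocal of
the polynomial `∏ᵢ (1 + Xᵢ²)`, continuous on the compact closed box hence integrable); by the
induction hypothesis `⟦Bₙ⟧ = ⟦A⟧ⁿ`, and the Fubini product `Bₙ × A : IntegralRep (n + 1)` has the
same domain as `B` (`(0,1)ⁿ × (0,1) = (0,1)ⁿ⁺¹`, the coordinates of `Fin (n + 1)` splitting as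
`castSucc i = castAdd 1 i` and `last n = natAdd n 0`) and the same integrand on it
(`Fin.prod_univ_castSucc`), so `⟦B⟧ = ⟦Bₙ × A⟧ = ⟦Bₙ⟧ · ⟦A⟧ = ⟦A⟧ⁿ⁺¹` (one integrand-additivity
move, then `KZ.toFormalPeriod_of_mul_of`).

References: M. Kontsevich, D. Zagier, *Periods* (2001), §1.1 (products of integrals are
integrals, "Fubini"), §1.2 rule (1), §4.1.
-/

noncomputable section

open Set MeasureTheory
open Literature.NumberTheory.Transcendental

namespace Summit.KontsevichZagierPeriods.HyperbolicBloch.OffTetraSectorKernel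

/-- **Arctangent boxes exist**: for every `n` there is an integral representation pinned as
`[(0,1)ⁿ, ∏ᵢ 1/(1+xᵢ²)]` — the open box is `ℚ`-semialgebraic (`KZ.isSemialgebraic_box`), the
integrand is the quotient `1 / ∏ᵢ (1 + Xᵢ²)` of `ℚ`-polynomials with non-vanishing denominator
(`isSemialgebraicFunOn_aeval_div_aeval`), and it is continuous on the compact closed box `[0,1]ⁿ`,
hence absolutely integrable on the open one. [cite: KontsevichZagier2001, §1.1] -/
theorem arctanBox_exists (n : ℕ) :
    ∃ r : KZ.IntegralRep n, r.domain = {x | ∀ i, x i ∈ Set.Ioo (0:ℝ) 1} ∧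
      Set.EqOn r.integrand (fun x => ∏ i, 1 / (1 + x i ^ 2)) r.domain := by
  refine ⟨⟨{x | ∀ i, x i ∈ Set.Ioo (0:ℝ) 1}, fun x => ∏ i, 1 / (1 + x i ^ 2),
    KZ.isSemialgebraic_box n, ?_, ?_⟩, rfl, fun _ _ => rfl⟩
  · refine (isSemialgebraicFunOn_aeval_div_aeval (KZ.isSemialgebraic_box n) 1
      (∏ i : Fin n, (1 + MvPolynomial.X i ^ 2 : MvPolynomial (Fin n) ℚ)) fun x _ => ?_).congr
      fun x _ => ?_
    · rw [map_prod]
      exact Finset.prod_ne_zero_iff.mpr fun i _ => by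
        simp only [map_add, map_one, map_pow, MvPolynomial.aeval_X]
        positivity
    · simp [map_prod, Finset.prod_inv_distrib]
  · have hcont : Continuous fun x : Fin n → ℝ => ∏ i, 1 / (1 + x i ^ 2) :=
      continuous_finsetProd _ fun i _ => continuous_const.div (by fun_prop) fun x => by positivity
    exact (hcont.continuousOn.integrableOn_compact
      (isCompact_Icc (a := (0 : Fin n → ℝ)) (b := 1))).mono_set
      fun x hx => ⟨fun i => (hx i).1.le, fun i => (hx i).2.le⟩

/-- **Dimension zero**: a representation pinned as the arctangent box with no variables (domain
`(0,1)⁰ = ℝ⁰ = {pt}`, integrand the empty product `1`) has the formal period `1 = ⟦[pt, 1]⟧`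
(one integrand-additivity move against the unit representation).
[cite: KontsevichZagier2001, §4.1] -/
theorem arctanBox_zero_toFormalPeriod (B : KZ.IntegralRep 0)
    (hBd : B.domain = {x | ∀ i, x i ∈ Set.Ioo (0:ℝ) 1})
    (hBi : Set.EqOn B.integrand (fun x => ∏ i, 1 / (1 + x i ^ 2)) B.domain) :
    KZ.toFormalPeriod (KZ.of B) = 1 := by
  rw [← KZ.toFormalPeriod_of_unit, KZ.toFormalPeriod_eq_iff]
  refine KZ.of_sub_of_mem_relations_of_eqOn ?_ fun t ht => ?_
  · rw [KZ.IntegralRep.unit_domain, hBd]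
    ext t
    simp
  · rw [hBi ht, KZ.IntegralRep.unit_integrand]
    simp

/-- **Peeling off the last variable**: a representation `B` pinned as the arctangent box in
dimension `n + 1` has the same formal period as the Fubini product `Bₙ × A` of a representation
`Bₙ` pinned as the arctangent box in dimension `n` with an arctangent carrier `A` — both have the
domain `(0,1)ⁿ⁺¹ = (0,1)ⁿ × (0,1)` and the same integrand on it (`Fin.prod_univ_castSucc`; the
integrand of `Bₙ × A` is `Bₙ ⊗ A`, `KZ.IntegralRep.prod_integrand_eq`): one integrand-additivity
move (`KZ.of_sub_of_mem_relations_of_eqOn`). [cite: KontsevichZagier2001, §4.1] -/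
theorem arctanBox_succ_toFormalPeriod (n : ℕ) (A : KZ.IntegralRep 1) (Bn : KZ.IntegralRep n)
    (B : KZ.IntegralRep (n + 1))
    (hAd : A.domain = {t | t 0 ∈ Set.Ioo (0:ℝ) 1})
    (hAi : Set.EqOn A.integrand (fun t => 1 / (1 + t 0 ^ 2)) A.domain)
    (hBnd : Bn.domain = {x | ∀ i, x i ∈ Set.Ioo (0:ℝ) 1})
    (hBni : Set.EqOn Bn.integrand (fun x => ∏ i, 1 / (1 + x i ^ 2)) Bn.domain)
    (hBd : B.domain = {x | ∀ i, x i ∈ Set.Ioo (0:ℝ) 1})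
    (hBi : Set.EqOn B.integrand (fun x => ∏ i, 1 / (1 + x i ^ 2)) B.domain) :
    KZ.toFormalPeriod (KZ.of B) = KZ.toFormalPeriod (KZ.of (Bn.prod A)) := by
  have hlast : Fin.natAdd n (0 : Fin 1) = Fin.last n := Fin.ext (by simp)
  -- membership in the box of dimension `n + 1`, blockwise
  have hmem : ∀ z : Fin (n + 1) → ℝ, z ∈ B.domain ↔
      (∀ i : Fin n, z (Fin.castAdd 1 i) ∈ Set.Ioo (0:ℝ) 1) ∧
        z (Fin.natAdd n (0 : Fin 1)) ∈ Set.Ioo (0:ℝ) 1 := by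
    intro z
    rw [hBd, mem_setOf_eq, Fin.forall_fin_succ', hlast]
    rfl
  rw [KZ.toFormalPeriod_eq_iff]
  refine KZ.of_sub_of_mem_relations_of_eqOn ?_ fun z hz => ?_
  · ext z
    rw [hmem, KZ.IntegralRep.prod_domain, KZ.IntegralRep.mem_prodDomain, hBnd, hAd]
    rfl
  · obtain ⟨hzn, hz1⟩ := (hmem z).1 hz
    have hzBn : (fun i : Fin n => z (Fin.castAdd 1 i)) ∈ Bn.domain := by rw [hBnd]; exact hzn
    have hzA : (fun j : Fin 1 => z (Fin.natAdd n j)) ∈ A.domain := by rw [hAd]; exact hz1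
    rw [KZ.IntegralRep.prod_integrand_eq, KZ.IntegralRep.prodFun_apply, hBni hzBn, hAi hzA,
      hBi hz]
    dsimp only
    rw [Fin.prod_univ_castSucc, hlast]
    rfl

/-- **Arctangent boxes are powers of the arctangent carrier** (registered stub
`stub_arctanBoxPower`): for an arctangent carrier `A = [(0,1), 1/(1+t²)]` and a representation `B`
pinned as the arctangent box `[(0,1)ⁿ, ∏ᵢ 1/(1+xᵢ²)]`, `⟦B⟧ = ⟦A⟧ⁿ` in the formal period ring
(`⟦r × s⟧ = ⟦r⟧·⟦s⟧`, `KZ.toFormalPeriod_of_mul_of`; induction on `n`, the pinned box in dimension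
`n + 1` being the Fubini product of a box in dimension `n` (which exists, `arctanBox_exists`) with
the carrier up to rule (1b) with a zero difference; `n = 0` is the unit `[pt, 1]`).
[cite: KontsevichZagier2001, §4.1] -/
theorem stub_arctanBoxPower :
    ∀ (n : ℕ) (A : KZ.IntegralRep 1) (B : KZ.IntegralRep n), A.domain = {t | t 0 ∈ Set.Ioo (0:ℝ) 1} →
      Set.EqOn A.integrand (fun t => 1 / (1 + t 0 ^ 2)) A.domain →
      B.domain = {x | ∀ i, x i ∈ Set.Ioo (0:ℝ) 1} →
      Set.EqOn B.integrand (fun x => ∏ i, 1 / (1 + x i ^ 2)) B.domain →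
      KZ.toFormalPeriod (KZ.of B) = KZ.toFormalPeriod (KZ.of A) ^ n := by
  intro n A
  induction n with
  | zero =>
    intro B _ _ hBd hBi
    rw [pow_zero]
    exact arctanBox_zero_toFormalPeriod B hBd hBi
  | succ n ih =>
    intro B hAd hAi hBd hBi
    obtain ⟨Bn, hBnd, hBni⟩ := arctanBox_exists n
    rw [pow_succ, ← ih Bn hAd hAi hBnd hBni, KZ.toFormalPeriod_of_mul_of]
    exact arctanBox_succ_toFormalPeriod n A Bn B hAd hAi hBnd hBni hBd hBi

end Summit.KontsevichZagierPeriods.HyperbolicBloch.OffTetraSectorKernel
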